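import Literature.Barriers.MatrixMultiplication.IrreversibilityBarrierThm9
import Literature.Barriers.MatrixMultiplication.IrreversibilityBarrierThm13
import Literature.Barriers.MatrixMultiplication.IrreversibilityBarrierThm19
import Literature.Barriers.MatrixMultiplication.IrreversibilityBarrierThm22
import HarnessLib

/-!
# The irreversibility barrier (Christandl–Vrana–Zuiddam 2021): the catalogue entry proved

Topic `Literature/Barriers/MatrixMultiplication`; DISCHARGE of the D-0021 catalogue entry
`IrreversibilityBarrier` of `IrreversibilityBarrier.lean` (M. Christandl, P. Vrana, J. Zuiddam,
*Barriers for fast matrix multiplication from irreversibility*, Theory of Computing 17 (2021),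
art. 2 = arXiv:1812.06952; **arXiv numbering**: Thm. 9 p. 7, Thm. 13 p. 8, Thm. 19 p. 9, Thm. 22
p. 10), which is by definition the conjunction
`CVZ2021_thm9 ∧ CVZ2021_thm13 ∧ CVZ2021_thm19 ∧ CVZ2021_thm22`.
The four conjuncts are proved in the sibling files

* `IrreversibilityBarrierThm9.lean` — `CVZ2021_thm9_holds`: `ω(⟨2⟩,t) ω(t,⟨2,2,2⟩) ≥ 2 i(t)`
  (triangle inequality for relative exponents, `RelativeExponentTriangle.lean`, and
  `ω(⟨2,2,2⟩,⟨2⟩) ≤ 1/2` from the Ruzsa–Szemerédi/Behrend induced matchings in the support of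
  `⟨N,N,N⟩`, `MatMulMonomialSubrank(Asymptotics).lean`);
* `IrreversibilityBarrierThm13.lean` — `CVZ2021_thm13_holds`: the monomial form
  `ω(⟨2⟩,t) ω_M(t,⟨2,2,2⟩) ≥ 2 i_M(t)` (same construction, which is a monomial restriction);
* `IrreversibilityBarrierThm19.lean` — `CVZ2021_thm19_holds`:
  `2 i(cw_q) ≥ 2 log₂(q+1)/(log₂ 3 − 2/3 + (2/3) log₂ q)` (flattening rank `q+1`; slice-rank count
  for the powers of `cw_q`);
* `IrreversibilityBarrierThm22.lean` — `CVZ2021_thm22_holds`: `2 i(CW_q) ≥ 2 log₂(q+2)/f_q(x_q)`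
  (flattening rank `q+2`; Alman's finite slice-rank bound for `CW_q^{⊗m}` and the tangent-line
  certificate at the printed maximiser `x_q`);

all for the tree's infimum formalisation of relative exponents (`RelativeExponent.lean`) and over
arbitrary fields, exactly as vendored. This file only assembles them: `IrreversibilityBarrier_holds`.
(Independent supporting files by this unit: `RelativeExponentTriangle.lean` — used by the proof of
Thm. 9 — and `IrreversibilityBarrierGaugeBounds.lean`, the flattening-rank / weighted-block bounds
`log₂ ζ⁽¹⁾(t) ≤ ω(⟨2⟩,t)`, `1/log₂(1/θ) ≤ ω(t,⟨2⟩)` in general form.)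

## References

* M. Christandl, P. Vrana, J. Zuiddam, ToC 17 (2021), art. 2 = arXiv:1812.06952, Thm. 9, 13,
  19, 22. [ChristandlVranaZuiddam2021]
-/

namespace Literature.Barriers.MatrixMultiplication

/-- **The irreversibility barrier for fast matrix multiplication, PROVED** (discharge of the
catalogue entry `IrreversibilityBarrier = CVZ2021_thm9 ∧ CVZ2021_thm13 ∧ CVZ2021_thm19 ∧ CVZ2021_thm22`):
for every fixed intermediate tensor `t` the certified bound `ω(⟨2⟩,t) ω(t,⟨2,2,2⟩)` is `≥ 2 i(t)`
(Thm. 9), monomially `≥ 2 i_M(t)` (Thm. 13), with `2 i(cw_q) ≥ 2 log₂(q+1)/(log₂ 3 − 2/3 + (2/3)log₂ q)`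
(Thm. 19) and `2 i(CW_q) ≥ 2 log₂(q+2)/f_q(x_q)` (Thm. 22).
[cite: ChristandlVranaZuiddam2021, Thm. 9] [cite: ChristandlVranaZuiddam2021, Thm. 13]
[cite: ChristandlVranaZuiddam2021, Thm. 19] [cite: ChristandlVranaZuiddam2021, Thm. 22] -/
theorem IrreversibilityBarrier_holds : IrreversibilityBarrier :=
  ⟨CVZ2021_thm9_holds, CVZ2021_thm13_holds, CVZ2021_thm19_holds, CVZ2021_thm22_holds⟩

/-- The headline numerical barrier, now unconditional: through any fixed big Coppersmith–Winograd
tensor `CW_q` (`q ≥ 1`, any field) the certified bound `ω(⟨2⟩,CW_q) · ω(CW_q,⟨2,2,2⟩)` is at least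
`2 log₂(q+2)/f_q(x_q)` (`≥ 2.16..`). [cite: ChristandlVranaZuiddam2021, Thm. 22 and Rem. 23] -/
theorem irreversibilityBarrier_bigCw (K : Type) [Field K] {q : ℕ} (hq : 1 ≤ q) :
    2 * Real.logb 2 (q + 2) / cvzEntropy q (cvzArgmax q) ≤
      Literature.Computability.AlgebraicComplexity.relativeExponent
          (Literature.Computability.AlgebraicComplexity.unitTensor K 2) (bigCwTensor K q) *
        Literature.Computability.AlgebraicComplexity.relativeExponent (bigCwTensor K q)
          (Literature.Computability.AlgebraicComplexity.matMulTensor K 2 2 2) :=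
  IrreversibilityBarrier_holds.bigCw K hq

/-- Likewise for the small Coppersmith–Winograd tensors: through any fixed `cw_q` (`q ≥ 1`) the
certified bound is at least `2 log₂(q+1)/(log₂ 3 − 2/3 + (2/3) log₂ q)` (`= 2` at `q = 2`, `≥ 2.02..`
for `q ≥ 3`). [cite: ChristandlVranaZuiddam2021, Thm. 19 and Rem. 20] -/
theorem irreversibilityBarrier_cw (K : Type) [Field K] {q : ℕ} (hq : 1 ≤ q) :
    2 * Real.logb 2 (q + 1) / (Real.logb 2 3 - 2 / 3 + 2 / 3 * Real.logb 2 q) ≤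
      Literature.Computability.AlgebraicComplexity.relativeExponent
          (Literature.Computability.AlgebraicComplexity.unitTensor K 2)
          (Literature.Computability.AlgebraicComplexity.cwTensor K q) *
        Literature.Computability.AlgebraicComplexity.relativeExponent
          (Literature.Computability.AlgebraicComplexity.cwTensor K q)
          (Literature.Computability.AlgebraicComplexity.matMulTensor K 2 2 2) :=
  IrreversibilityBarrier_holds.thm19.cw_barrier IrreversibilityBarrier_holds.thm9 K hq

end Literature.Barriers.MatrixMultiplication
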